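import Literature.MathematicalPhysics.QuantumLattice.HubbardOpenBoxEDCertificateKronecker
import Literature.MathematicalPhysics.QuantumLattice.HubbardSpinFlipSymmetry
import HarnessLib

/-!
# Data-free sector certificates: halving the work by the spin-exchange symmetry

Topic `MathematicalPhysics/QuantumLattice`, family `hubbard`. Companion of
`HubbardOpenBoxEDCertificateKronecker`. The spin exchange `(x, σ) ↦ (x, 1 − σ)` is implemented on Fock
space by the signed permutation `relabelVec Orb.spinSwap` and commutes with every `t–t'` Hubbard cluster
Hamiltonian (`relabel_spinSwap_hamiltonian`, Lieb 1989: "the Hamiltonian is symmetric between the up and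
the down spins"); it maps the spin sector `(N↑, N↓) = (q, p)` onto `(p, q)`. Hence a quadratic-form floor
certified on the sector `(p, q)` holds verbatim on `(q, p)` (`sectorFloor_spinSwap`), and the assembly of
kernel certificates into `N`-particle floors needs certificates for the sectors with `p ≤ q` ONLY
(**`groundEnergy_ge_of_kCerts₂`** — the kernel work of a cluster point drops by the share of the sectors
with `p > q`, e.g. `35 %` for the open `2 × 3` cluster).

Everything is proved; no named fact; nothing numerical is asserted here.

## References

* E. H. Lieb, PRL 62 (1989) 1201, proof of Thm 1. [cite: LiebPRL1989, proof of Theorem 1]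
* O. Bratteli, D. W. Robinson, *Operator Algebras and Quantum Statistical Mechanics II* (1997), §5.2.2,
  Thm 5.2.5 (unitarily implemented Bogoliubov transformations). [cite: BratteliRobinsonII1997, §5.2.2 Thm. 5.2.5]
* I. Kull, N. Schuch, B. Dive, M. Navascués, PRX 14 (2024) 021008, §5.3. [cite: KullEtAl2024, §5.3]
-/

namespace Literature.MathematicalPhysics.QuantumLattice

namespace OccupationCode

open Finset Matrix

section Swap

variable {Λ : Type*} [LinearOrder Λ] [Fintype Λ]

omit [LinearOrder Λ] [Fintype Λ] in
/-- `spinSwap⁻¹ (x, σ) = (x, swap σ)`. [folklore] -/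
private theorem spinSwap_symm_orb'' (x : Λ) (σ : Fin 2) :
    (Orb.spinSwap : Orb Λ ≃ Orb Λ).symm (orb x σ) = orb x (Equiv.swap (0 : Fin 2) 1 σ) := by
  rw [Equiv.symm_apply_eq, Orb.spinSwap_orb, Equiv.swap_apply_self]

/-- Up sites of the spin-swapped configuration are the down sites (3-line copy of the tree's
`upPart_finsetCongr_spinSwap`, whose home file carries the thermal stack). [folklore] -/
private theorem upPart_finsetCongr_spinSwap'' (s : Finset (Orb Λ)) :
    upPart ((Orb.spinSwap : Orb Λ ≃ Orb Λ).finsetCongr s) = downPart s := by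
  ext x
  rw [mem_upPart, Equiv.finsetCongr_apply, Finset.mem_map_equiv, spinSwap_symm_orb'', Equiv.swap_apply_left,
    mem_downPart]

/-- Down sites of the spin-swapped configuration are the up sites. [folklore] -/
private theorem downPart_finsetCongr_spinSwap'' (s : Finset (Orb Λ)) :
    downPart ((Orb.spinSwap : Orb Λ ≃ Orb Λ).finsetCongr s) = upPart s := by
  ext x
  rw [mem_downPart, Equiv.finsetCongr_apply, Finset.mem_map_equiv, spinSwap_symm_orb'', Equiv.swap_apply_right,
    mem_upPart]

/-- **A quadratic-form floor on the spin sector `(p, q)` transfers to `(q, p)`** for every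
spin-exchange-invariant `H`: `σ ‖v‖² ≤ re ⟨v, H v⟩` for all `v` supported in `(N↑, N↓) = (p, q)` implies
the same for all `v` supported in `(q, p)` (apply the hypothesis to `Γ v`, `Γ = relabelVec Orb.spinSwap`,
which preserves norms and `H`-expectations). [cite: LiebPRL1989, proof of Theorem 1] -/
theorem sectorFloor_spinSwap (H : Matrix (Finset (Orb Λ)) (Finset (Orb Λ)) ℂ)
    (hH : relabel (Orb.spinSwap : Orb Λ ≃ Orb Λ) H = H) {p q : ℕ} {σ : ℝ}
    (h : ∀ v : Fock (Orb Λ), (∀ s, ¬((upPart s).card = p ∧ (downPart s).card = q) → v s = 0) →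
      σ * (star v ⬝ᵥ v).re ≤ (star v ⬝ᵥ (H *ᵥ v)).re) :
    ∀ v : Fock (Orb Λ), (∀ s, ¬((upPart s).card = q ∧ (downPart s).card = p) → v s = 0) →
      σ * (star v ⬝ᵥ v).re ≤ (star v ⬝ᵥ (H *ᵥ v)).re := by
  intro v hv
  have hw : ∀ s, ¬((upPart s).card = p ∧ (downPart s).card = q) →
      relabelVec (Orb.spinSwap : Orb Λ ≃ Orb Λ) v s = 0 := by
    intro s' hs'
    obtain ⟨s, rfl⟩ := (Orb.spinSwap : Orb Λ ≃ Orb Λ).finsetCongr.surjective s'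
    rw [relabelVec_apply_finsetCongr, hv s ?_, mul_zero]
    rw [upPart_finsetCongr_spinSwap'', downPart_finsetCongr_spinSwap''] at hs'
    exact fun h' => hs' ⟨h'.2, h'.1⟩
  have := h _ hw
  rwa [star_relabelVec_dotProduct, star_relabelVec_spinSwap_dotProduct_mulVec hH] at this

end Swap

section Assembly

/-- **The open-cluster `t–t'` Hamiltonian is spin-exchange invariant**: `Γ H^open Γ⁻¹ = H^open`.
[cite: LiebPRL1989, proof of Theorem 1] -/
theorem relabel_spinSwap_hubbardOpenBoxTT' (a b : ℕ) (t t' U : ℝ) :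
    relabel (Orb.spinSwap : Orb (Fin a ×ₗ Fin b) ≃ Orb (Fin a ×ₗ Fin b)) (hubbardOpenBoxTT' a b t t' U) =
      hubbardOpenBoxTT' a b t t' U := by
  unfold hubbardOpenBoxTT'
  rw [map_add, relabel_spinSwap_hamiltonian, relabel_spinSwap_hamiltonian]

/-- **Certificate form with the spin-exchange symmetry.** For the open `a × b` cluster with couplings
`(TN/Q, TD/Q, UU/Q)` and a particle number `k ≤ 2ab`: if for every `p ≤ k` with `p ≤ k − p` a data-free
certificate `certs p` with code list `Ls p` of the spin sector `(p, k − p)` passes the kernel checker and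
its floor is `≥ σ`, then `σ ≤ E₀(h^open_{a×b}, k)` (the sectors with `p > k − p` are the spin-exchange images
of certified ones). [cite: KullEtAl2024, §5.3] [cite: LiebPRL1989, proof of Theorem 1] -/
theorem groundEnergy_ge_of_kCerts₂ (a b : ℕ) (TN TD UU : ℤ) (Q : ℕ) {k : ℕ} (hk : k ≤ 2 * (a * b))
    (σ : ℚ) (Ls : ℕ → List ℕ) (certs : ℕ → KCert)
    (hcheck : ∀ p ≤ k, p ≤ k - p → (certs p).check a b p (k - p) TN TD UU Q (Ls p) = true)
    (hσ : ∀ p ≤ k, p ≤ k - p → σ ≤ (certs p).floor Q) :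
    (σ : ℝ) ≤ groundEnergy (hubbardOpenBoxTT' a b ((TN : ℝ) / Q) ((TD : ℝ) / Q) ((UU : ℝ) / Q)) k := by
  have hc : Fintype.card (Orb (Fin a ×ₗ Fin b)) = a * b * 2 := by
    simp [Fintype.card_prod, Fintype.card_lex, Fintype.card_fin]
  have hcard : k ≤ Fintype.card (Orb (Fin a ×ₗ Fin b)) := by rw [hc]; omega
  refine le_groundEnergy_of_spinSectorFloors _ (ThermodynamicLimit.preservesSectors_hubbardOpenBoxTT' a b _ _ _)
    hcard σ ?_
  have hnn : ∀ v : Fock (Orb (Fin a ×ₗ Fin b)), 0 ≤ (star v ⬝ᵥ v).re := fun v => by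
    rw [dotProduct, Complex.re_sum]
    exact Finset.sum_nonneg fun s _ => by
      rw [Pi.star_apply, mul_comm, RCLike.star_def, Complex.mul_conj]; simp [Complex.normSq_nonneg]
  -- a certified sector gives the floor `σ` directly
  have direct : ∀ p ≤ k, p ≤ k - p → ∀ v : Fock (Orb (Fin a ×ₗ Fin b)),
      (∀ s, ¬((upPart s).card = p ∧ (downPart s).card = k - p) → v s = 0) →
      (σ : ℝ) * (star v ⬝ᵥ v).re ≤
        (star v ⬝ᵥ (hubbardOpenBoxTT' a b ((TN : ℝ) / Q) ((TD : ℝ) / Q) ((UU : ℝ) / Q) *ᵥ v)).re := by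
    intro p hp hpp v hv
    have hs := (certs p).sound (hcheck p hp hpp) v hv
    have hfl : (σ : ℝ) ≤ (((certs p).floor Q : ℚ) : ℝ) := by exact_mod_cast hσ p hp hpp
    exact le_trans (mul_le_mul_of_nonneg_right hfl (hnn v)) hs
  intro p q hpq v hv
  by_cases hle : p ≤ q
  · have hp : p ≤ k := by omega
    have hq : q = k - p := by omega
    subst hq
    exact direct p hp hle v hv
  · have hq : q ≤ k := by omega
    have hqq : q ≤ k - q := by omega
    have hp : p = k - q := by omega
    subst hp
    exact sectorFloor_spinSwap _ (relabel_spinSwap_hubbardOpenBoxTT' a b _ _ _) (direct q hq hqq) v hv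

end Assembly

end OccupationCode

end Literature.MathematicalPhysics.QuantumLattice
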